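import Mathlib
import Literature.NumberTheory.Sieve.BombieriVinogradovReduction

/-!
# Auxiliary reduction for `stub_lowConductor` (crux `EH`, stmt-Parity-11314)

Line `upward-replication-free-factorability`.  Steps A–C of the Bombieri–Vinogradov reduction
(Davenport, *Multiplicative Number Theory*, ch. 28; Cojocaru–Murty, *An Introduction to Sieve
Methods*, §9.2; tree file `Literature/NumberTheory/Sieve/BombieriVinogradovReduction.lean`) for the
LOW-CONDUCTOR remainder `Δ(x;q,a) − Δ♯_D(x;q,a)` of the prime discrepancy
`Δ(x;q,a) = ψ(x;q,a) − x/φ(q)`, where `Δ♯_D(x;q,a) = φ(q)⁻¹ ∑_{χ mod q, cond χ > D} χ(a⁻¹) ψ(x,χ)`: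

* `norm_remainder_le` (Step A): orthogonality (`ArithmeticFunction.vonMangoldt.residueClass_apply`)
  gives `Δ(x;q,a) = φ(q)⁻¹ ∑_χ χ(a⁻¹) ψ'(x,χ)` exactly, so the remainder is
  `φ(q)⁻¹ ∑_{cond χ ≤ D} χ(a⁻¹) ψ'(x,χ)` (`ψ' = ψ` off the principal character, of conductor `1 ≤ D`);
* `sum_lowCond_le` (Steps B–C for one modulus): reindex the characters of conductor `≤ D` by
  `(d, χ₁)`, `d ∣ q`, `d ≤ D`, `χ₁` primitive mod `d`, and pass to the inducing character
  (`norm_psiPrime_changeLevel_le`, `norm_psiPrime_le_majorant`);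
* `stub_lowConductor_reduction` (the registered auxiliary stub): summing over `q ≤ Q` and swapping
  the `q`- and `d`-sums (`sum_mul_sum_divisors_eq`, `sum_filter_dvd_totient_inv_le`,
  `nonCoprimePart_le`),
  `∑_{q ≤ Q} max_a ‖Δ − Δ♯_D‖ ≤ W(Q) ∑_{d ≤ D} Φ(x; d) + ⌊log x/log 2⌋ Q log Q W(Q)`
  with the tree's `W = totientInvSum`, `Φ = primTerm`.

No definitions are introduced.  References: [DavenportMNT1980, ch. 28]; [CojocaruMurty2005, §9.2].
-/

namespace Summit.Parity.GeneralizedHardyLittlewood.Theorems.EH.LowConductorAux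

open Finset Literature.NumberTheory.Sieve
open scoped Classical

/-- Step A with the high conductors removed: for `(a, q) = 1` and a cut `D ≥ 1`,
`‖Δ(x;q,a) − φ(q)⁻¹∑_{cond χ > D} χ(a⁻¹)ψ(x,χ)‖ ≤ φ(q)⁻¹ ∑_{cond χ ≤ D} ‖ψ'(x,χ)‖`, from the exact
expansion `Δ(x;q,a) = φ(q)⁻¹ ∑_χ χ(a⁻¹) ψ'(x,χ)` (Davenport ch. 28) and `ψ' = ψ` for `χ ≠ χ₀`
(the principal character has conductor `1 ≤ D`). [cite: DavenportMNT1980, ch. 28] -/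
theorem norm_remainder_le (q : ℕ) [NeZero q] (a : (ZMod q)ˣ) (x : ℝ) {D : ℕ} (hD : 1 ≤ D) :
    ‖((ParityWave0.chebyshevPsiMod q (a : ZMod q) x - x / (Nat.totient q : ℝ) : ℝ) : ℂ) -
        ((Nat.totient q : ℂ))⁻¹ *
          ∑ χ ∈ (Finset.univ : Finset (DirichletCharacter ℂ q)) with D < χ.conductor,
            χ (a : ZMod q)⁻¹ * chebyshevPsiChar χ x‖ ≤
      (Nat.totient q : ℝ)⁻¹ *
        ∑ χ ∈ (Finset.univ : Finset (DirichletCharacter ℂ q)) with ¬ D < χ.conductor,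
          ‖psiPrime χ x‖ := by
  have ha : IsUnit ((a : ZMod q)) := a.isUnit
  have ha' : IsUnit ((a : ZMod q))⁻¹ := by
    rw [ZMod.inv_coe_unit]; exact (a⁻¹).isUnit
  have hφpos : 0 < (Nat.totient q : ℝ) := by exact_mod_cast Nat.totient_pos.mpr (NeZero.pos q)
  have h1 : ((ParityWave0.chebyshevPsiMod q a x : ℝ) : ℂ) = (Nat.totient q : ℂ)⁻¹ *
      ∑ χ : DirichletCharacter ℂ q, χ (a : ZMod q)⁻¹ * chebyshevPsiChar χ x := by
    simp only [ParityWave0.chebyshevPsiMod, Complex.ofReal_sum,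
      ArithmeticFunction.vonMangoldt.residueClass_apply ha, chebyshevPsiChar, Finset.mul_sum,
      mul_assoc]
    rw [Finset.sum_comm]
  have h3 : ∑ χ : DirichletCharacter ℂ q,
      χ (a : ZMod q)⁻¹ * (psiPrime χ x - chebyshevPsiChar χ x) = -x := by
    rw [Finset.sum_eq_single (1 : DirichletCharacter ℂ q)]
    · rw [psiPrime_one, MulChar.one_apply ha']; ring
    · intro χ _ hχ; rw [psiPrime_of_ne_one hχ]; ring
    · simp
  have h4 : ∑ χ : DirichletCharacter ℂ q, χ (a : ZMod q)⁻¹ * psiPrime χ x =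
      ∑ χ : DirichletCharacter ℂ q, χ (a : ZMod q)⁻¹ * chebyshevPsiChar χ x +
      ∑ χ : DirichletCharacter ℂ q, χ (a : ZMod q)⁻¹ * (psiPrime χ x - chebyshevPsiChar χ x) := by
    rw [← Finset.sum_add_distrib]
    exact Finset.sum_congr rfl fun χ _ => by ring
  have key : ((ParityWave0.chebyshevPsiMod q a x - x / (Nat.totient q : ℝ) : ℝ) : ℂ) =
      (Nat.totient q : ℂ)⁻¹ * ∑ χ : DirichletCharacter ℂ q,
        χ (a : ZMod q)⁻¹ * psiPrime χ x := by
    rw [h4, h3, mul_add, ← h1]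
    push_cast
    ring
  have hhigh : ∀ χ ∈ (Finset.univ : Finset (DirichletCharacter ℂ q)).filter
      (fun χ => D < χ.conductor),
      χ (a : ZMod q)⁻¹ * psiPrime χ x = χ (a : ZMod q)⁻¹ * chebyshevPsiChar χ x := by
    intro χ hχ
    have hne : χ ≠ 1 := by
      rintro rfl
      rw [Finset.mem_filter, DirichletCharacter.conductor_one] at hχ
      omega
    rw [psiPrime_of_ne_one hne]
  rw [key, ← Finset.sum_filter_add_sum_filter_not Finset.univ (fun χ => D < χ.conductor),
    Finset.sum_congr rfl hhigh, mul_add, add_sub_cancel_left, norm_mul, norm_inv,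
    Complex.norm_natCast]
  refine mul_le_mul_of_nonneg_left ((norm_sum_le _ _).trans (Finset.sum_le_sum fun χ _ => ?_))
    (inv_nonneg.2 hφpos.le)
  rw [norm_mul]
  exact mul_le_of_le_one_left (norm_nonneg _) (χ.norm_le_one _)

/-- Steps B–C for the characters of conductor `≤ D`: reindex by `(d, χ₁)` with `d ∣ q`, `d ≤ D`,
`χ₁` primitive mod `d` (`χ = changeLevel χ₁`, `d = cond χ`), and bound
`‖ψ'(x, χ)‖ ≤ M(x; d, χ₁) + R(q, x)` (`norm_psiPrime_changeLevel_le`, `norm_psiPrime_le_majorant`);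
there are at most `q` terms. [cite: CojocaruMurty2005, §9.2] -/
theorem sum_lowCond_le (q : ℕ) [NeZero q] {x : ℝ} (hx : 0 ≤ x) (D : ℕ) :
    ∑ χ ∈ (Finset.univ : Finset (DirichletCharacter ℂ q)) with ¬ D < χ.conductor, ‖psiPrime χ x‖ ≤
      ∑ d ∈ q.divisors with d ≤ D, (∑ χ ∈ (univ : Finset (DirichletCharacter ℂ d)).filter
          DirichletCharacter.IsPrimitive, majorant x ⟨d, χ⟩) + q * nonCoprimePart q x := by
  set T : Finset (Σ d : ℕ, DirichletCharacter ℂ d) := (q.divisors.filter (· ≤ D)).sigma fun d =>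
    (univ : Finset (DirichletCharacter ℂ d)).filter DirichletCharacter.IsPrimitive with hT
  have hTsub : T ⊆ primIndex q := fun σ hσ => by
    rw [hT, Finset.mem_sigma, Finset.mem_filter] at hσ
    rw [primIndex, Finset.mem_sigma]
    exact ⟨hσ.1.1, hσ.2⟩
  have himage : (Finset.univ : Finset (DirichletCharacter ℂ q)).filter
      (fun χ => ¬ D < χ.conductor) ⊆ T.image (induce q) := by
    intro χ hχ
    rw [Finset.mem_filter] at hχ
    refine Finset.mem_image.2 ⟨⟨χ.conductor, χ.primitiveCharacter⟩, ?_, ?_⟩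
    · rw [hT, Finset.mem_sigma, Finset.mem_filter, Finset.mem_filter, Nat.mem_divisors]
      exact ⟨⟨⟨χ.conductor_dvd_level, NeZero.ne q⟩, not_lt.1 hχ.2⟩, Finset.mem_univ _,
        χ.primitiveCharacter_isPrimitive⟩
    · rw [induce, dif_pos χ.conductor_dvd_level]
      exact χ.changeLevel_primitiveCharacter
  have h2 : ∀ σ ∈ T, ‖psiPrime (induce q σ) x‖ ≤ majorant x σ + nonCoprimePart q x := by
    intro σ hσ
    have hσ' := hTsub hσ
    have hdq : σ.1 ∣ q := (mem_primIndex.1 hσ').1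
    rw [induce, dif_pos hdq]
    refine (norm_psiPrime_changeLevel_le hdq σ.2 x).trans ?_
    gcongr
    exact norm_psiPrime_le_majorant hσ' hx le_rfl
  calc ∑ χ ∈ (Finset.univ : Finset (DirichletCharacter ℂ q)) with ¬ D < χ.conductor, ‖psiPrime χ x‖
      ≤ ∑ χ ∈ T.image (induce q), ‖psiPrime χ x‖ :=
        Finset.sum_le_sum_of_subset_of_nonneg himage fun _ _ _ => norm_nonneg _
    _ ≤ ∑ σ ∈ T, ‖psiPrime (induce q σ) x‖ :=
        Finset.sum_image_le_of_nonneg fun _ _ => norm_nonneg _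
    _ ≤ ∑ σ ∈ T, (majorant x σ + nonCoprimePart q x) := Finset.sum_le_sum h2
    _ = ∑ σ ∈ T, majorant x σ + T.card * nonCoprimePart q x := by
        rw [Finset.sum_add_distrib, Finset.sum_const, nsmul_eq_mul]
    _ ≤ _ := by
        rw [hT, Finset.sum_sigma]
        gcongr
        · exact nonCoprimePart_nonneg q x
        · exact_mod_cast (Finset.card_le_card hTsub).trans (card_primIndex_le q)

/-- **The reduction** (registered auxiliary stub `stub_lowConductor_reduction`): Steps A–C
summed over `q ≤ Q` with the order of summation swapped
(`sum_mul_sum_divisors_eq`, `sum_filter_dvd_totient_inv_le`, `nonCoprimePart_le`):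
`∑_{q ≤ Q} max_a ‖Δ − Δ♯_D‖ ≤ W(Q) ∑_{d ≤ D} Φ(x; d) + ⌊log x/log 2⌋ Q log Q W(Q)`.
[cite: CojocaruMurty2005, §9.2] -/
theorem stub_lowConductor_reduction :
    ∀ (Q D : ℕ), 1 ≤ D → ∀ x : ℝ, 0 ≤ x →
      ∑ q ∈ Finset.Icc 1 Q, ⨆ a : (ZMod q)ˣ,
          ‖((Literature.NumberTheory.Sieve.ParityWave0.chebyshevPsiMod q (a : ZMod q) x -
                  x / (Nat.totient q : ℝ) : ℝ) : ℂ) -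
              ((Nat.totient q : ℂ))⁻¹ *
                ∑ χ ∈ (Finset.univ : Finset (DirichletCharacter ℂ q)) with D < χ.conductor,
                  χ (a : ZMod q)⁻¹ * Literature.NumberTheory.Sieve.chebyshevPsiChar χ x‖ ≤
        Literature.NumberTheory.Sieve.totientInvSum Q *
            ∑ d ∈ Finset.Icc 1 D, Literature.NumberTheory.Sieve.primTerm x d +
          ⌊Real.log x / Real.log 2⌋₊ *
            ((Q : ℝ) * Real.log Q * Literature.NumberTheory.Sieve.totientInvSum Q) := by
  intro Q D hD x hx
  set G : ℕ → ℝ := fun d => ∑ χ ∈ (univ : Finset (DirichletCharacter ℂ d)).filter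
    DirichletCharacter.IsPrimitive, majorant x ⟨d, χ⟩ with hG
  set F : ℕ → ℝ := fun d => if d ≤ D then G d else 0 with hF
  have hG0 : ∀ d, 0 ≤ G d := fun d => Finset.sum_nonneg fun _ _ => majorant_nonneg x _
  have hF0 : ∀ d, 0 ≤ F d := fun d => by
    simp only [hF]
    split_ifs
    exacts [hG0 d, le_rfl]
  have h1 : ∀ q ∈ Icc 1 Q, ⨆ a : (ZMod q)ˣ,
      ‖((ParityWave0.chebyshevPsiMod q (a : ZMod q) x - x / (Nat.totient q : ℝ) : ℝ) : ℂ) -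
          ((Nat.totient q : ℂ))⁻¹ *
            ∑ χ ∈ (Finset.univ : Finset (DirichletCharacter ℂ q)) with D < χ.conductor,
              χ (a : ZMod q)⁻¹ * chebyshevPsiChar χ x‖ ≤
      ((Nat.totient q : ℝ))⁻¹ * ∑ d ∈ q.divisors, F d +
        ⌊Real.log x / Real.log 2⌋₊ * ((Q : ℝ) * Real.log Q) * ((Nat.totient q : ℝ))⁻¹ := by
    intro q hq
    have hq1 : 1 ≤ q := (Finset.mem_Icc.1 hq).1
    have hqQ : q ≤ Q := (Finset.mem_Icc.1 hq).2
    haveI : NeZero q := ⟨by omega⟩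
    have hφ : 0 < (Nat.totient q : ℝ) := by exact_mod_cast Nat.totient_pos.2 hq1
    refine ciSup_le fun a => (norm_remainder_le q a x hD).trans ?_
    have h2 := sum_lowCond_le q hx D
    rw [Finset.sum_filter (fun d => d ≤ D)] at h2
    calc (Nat.totient q : ℝ)⁻¹ *
          ∑ χ ∈ (Finset.univ : Finset (DirichletCharacter ℂ q)) with ¬ D < χ.conductor,
            ‖psiPrime χ x‖
        ≤ (Nat.totient q : ℝ)⁻¹ * (∑ d ∈ q.divisors, F d + q * nonCoprimePart q x) :=
          mul_le_mul_of_nonneg_left h2 (inv_nonneg.2 hφ.le)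
      _ = (Nat.totient q : ℝ)⁻¹ * ∑ d ∈ q.divisors, F d +
            (q : ℝ) / Nat.totient q * nonCoprimePart q x := by ring
      _ ≤ _ := by
          gcongr ?_ + ?_
          · exact le_rfl
          calc (q : ℝ) / Nat.totient q * nonCoprimePart q x
              ≤ (q : ℝ) / Nat.totient q * (⌊Real.log x / Real.log 2⌋₊ * Real.log q) :=
                mul_le_mul_of_nonneg_left (nonCoprimePart_le (by omega) hx) (by positivity)
            _ ≤ (Q : ℝ) / Nat.totient q * (⌊Real.log x / Real.log 2⌋₊ * Real.log Q) := by
                gcongr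
            _ = _ := by ring
  refine (Finset.sum_le_sum h1).trans ?_
  rw [Finset.sum_add_distrib, ← Finset.mul_sum, sum_mul_sum_divisors_eq Q]
  refine add_le_add ?_ (le_of_eq ?_)
  · calc ∑ d ∈ Icc 1 Q, F d * ∑ q ∈ Icc 1 Q with d ∣ q, ((Nat.totient q : ℝ))⁻¹
        ≤ ∑ d ∈ Icc 1 Q, F d * (((Nat.totient d : ℝ))⁻¹ * totientInvSum Q) :=
          Finset.sum_le_sum fun d hd => mul_le_mul_of_nonneg_left
            (sum_filter_dvd_totient_inv_le Q (Finset.mem_Icc.1 hd).1) (hF0 d)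
      _ = totientInvSum Q * ∑ d ∈ Icc 1 Q, if d ≤ D then primTerm x d else 0 := by
          rw [Finset.mul_sum]
          refine Finset.sum_congr rfl fun d _ => ?_
          simp only [hF, hG, primTerm]
          split_ifs <;> ring
      _ ≤ totientInvSum Q * ∑ d ∈ Icc 1 D, primTerm x d := by
          rw [← Finset.sum_filter]
          refine mul_le_mul_of_nonneg_left (Finset.sum_le_sum_of_subset_of_nonneg (fun d hd => ?_)
            fun d _ _ => primTerm_nonneg x d) (totientInvSum_nonneg Q)
          rw [Finset.mem_filter, Finset.mem_Icc] at hd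
          exact Finset.mem_Icc.2 ⟨hd.1.1, hd.2⟩
  · rw [totientInvSum]; ring

end Summit.Parity.GeneralizedHardyLittlewood.Theorems.EH.LowConductorAux
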